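import Literature.NumberTheory.Sieve.BombieriFriedlanderIwaniecTheorem5Reciprocity
import HarnessLib

/-!
# Bombieri–Friedlander–Iwaniec 1986, Theorem 5 — step 6: squaring out `𝒜` (the arithmetic of Lemma 6)

Topic `Literature/NumberTheory/Sieve`; continuation of `…Theorem5Reciprocity`, which reduced the
named fact `Literature.NumberTheory.Sieve.BombieriFriedlanderIwaniecTheorem5` to BFI's Lemma 6, the
bound (8.4) for the sum `𝒜(C, D, K, H, Q)` (`BFI.dispA`).  BFI prove Lemma 6 from Lemma 1
(= Deshouillers–Iwaniec, Invent. Math. 70 (1982), Theorem 12: the bound for the sums of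
Kloosterman sums `𝒦(C, D, N, R, S)`) in half a page (p. 227):

> "Squaring and changing the order of summation we represent `𝒜(C, D, K, H, Q)` as
> `𝒦(C, D, |a|HKQ, Q², 1)` with the coefficients
> `B_{nr} = ∑_{q₁q₂ = r} ∑_{h₁,h₂ ≤ H, ak(h₁q₂ − h₂q₁) = n} ∑_{k ≤ K} α(h₁,q₁) ᾱ(h₂,q₂)`.
> The terms on the diagonal (`n = 0`) … contribute trivially `≪ CDHKQ (log 2HQ)⁴`.  The terms
> off the diagonal, by Lemma 1, contribute `≪ (CDHKQ)^ε 𝓘(C, D, |a|HKQ, Q², 1) ‖B‖` where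
> `‖B‖² = ∑_{n ≥ 1} ∑_r |B_{nr}|² ≪ (HKQ)^ε K ∑_{q₁,q₂} ∑_l (∑_{h₁q₂ − h₂q₁ = l} 1)²
> = (HKQ)^ε K #{q₁, q₂, h₁, h₂, h₃, h₄ : (h₁ − h₃)q₂ = (h₂ − h₄)q₁} ≪ (HKQ)^ε K (H²Q² + H³Q)`."

This file PROVES the arithmetic content of that paragraph, for `BFI.dispA` exactly as defined:

* `BFI.innerS`, `BFI.dispA_eq_sum_innerS` — the inner sum `S(c,d,k)` of `𝒜`;
* `BFI.phase_mul_conj_phase` — the phase identity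
  `e(h₁k·a(dq₁)‾/c) conj e(h₂k·a(dq₂)‾/c) = e(n (q₁q₂d)‾/c)`, `n = ak(h₁q₂ − h₂q₁)`;
* `BFI.sum_norm_innerS_sq_eq` — **squaring out**: `∑_k ‖S(c,d,k)‖² = ∑_{κ,η} w(κ,η) F_{c,d}(n, r)`
  over shapes `κ = (k, q₁, q₂)` and heights `η = (h₁, h₂)`, with the Kloosterman-fraction phase
  `BFI.kfrac c d n r = [ (rd, c) = 1 ] e(n (rd)‾/c)` of Lemma 1 (at `s = 1`);
* `BFI.Bcoef` (the `B_{nr}`), `BFI.sum_wcoef_mul_eq` — regrouping by `(n, r)`;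
* `BFI.sum_norm_Bcoef_zero_le` — **the diagonal**: `∑_r ‖B(0, r)‖ ≤ K₀Q₀H₀ · max τ`;
* `BFI.sum_norm_Bcoef_sq_le` — **`‖B‖²` off the diagonal**:
  `∑_{n ≠ 0} ∑_r ‖B(n,r)‖² ≤ max τ(|n|) · max τ(r) · K₀ Q₀ H₀² (Q₀ + H₀ max τ)`, i.e. BFI's
  `K(H²Q² + H³Q)` up to divisor functions, via Cauchy over the `≤ τ(|n|)τ(r)` shapes carrying
  `(n, r)` (`BFI.card_support_cfib_le`) and the lattice-point count (`BFI.sum_card_lval_eq_le`).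

Divisor functions are kept as explicit parameters `T ≥ τ(·)`; the `x^ε`-bookkeeping, the smooth
dyadic weights `g(c, d)` and the appeal to Lemma 1 are the next step.  Everything here is PROVED
(finite combinatorics and congruences); no named facts are introduced.  (The sibling file
`…Lemma6Counting` proves the two lattice-point counts of p. 227 in BFI's sharper `gcd` form,
`ν(l; q₁, q₂) ≤ H(q₁,q₂)/max(q₁,q₂) + 1`; here the counts are organised directly around the
coefficients `B(n, r)` of `BFI.dispA` and bounded through `τ`, which is all that (8.4) needs.)

## References

* E. Bombieri, J. B. Friedlander, H. Iwaniec, *Primes in arithmetic progressions to large moduli*,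
  Acta Math. 156 (1986), 203–251: §2 Lemma 1 p. 208, §8 (8.2)–(8.4) and the proof of Lemma 6,
  pp. 226–227. [BombieriFriedlanderIwaniecActa1986]
* J.-M. Deshouillers, H. Iwaniec, *Kloosterman sums and Fourier coefficients of cusp forms*,
  Invent. Math. 70 (1982), 219–288, Theorem 12 (the source of Lemma 1; not used here).
-/

noncomputable section

open Finset Real
open scoped ArithmeticFunction.sigma ContDiff FourierTransform ComplexConjugate

namespace Literature.NumberTheory.Sieve

namespace BFI

/-! ### The inner sum of `𝒜` and the index sets of its square -/

/-- The inner sum of `𝒜(C, D, K, H, Q)` at `(c, d, k)` ((8.2), p. 226):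
`S(c,d,k) = ∑_{h ≤ H} ∑_{q ≤ Q, (dq,c)=1} α(h,q) e(hk·(a(dq)‾ mod c)/c)`.
[cite: BombieriFriedlanderIwaniecActa1986, §8 (8.2) p. 226] -/
def innerS (a : ℤ) (H Q : ℝ) (α : ℕ → ℕ → ℂ) (c d k : ℕ) : ℂ :=
  ∑ h ∈ Finset.Icc 1 ⌊H⌋₊, ∑ q ∈ (Finset.Icc 1 ⌊Q⌋₊).filter (fun q => c.Coprime (d * q)),
    α h q * (𝐞 (((((a : ZMod c) * ((d * q : ℕ) : ZMod c)⁻¹).val : ℕ) : ℝ) * h * k / c) : ℂ)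

/-- `𝒜 = ∑_{c ≤ C} ∑_{d ≤ D} ∑_{k ≤ K} ‖S(c,d,k)‖²`. [folklore] -/
theorem dispA_eq_sum_innerS (a : ℤ) (C D K H Q : ℝ) (α : ℕ → ℕ → ℂ) :
    dispA a C D K H Q α = ∑ c ∈ Finset.Icc 1 ⌊C⌋₊, ∑ d ∈ Finset.Icc 1 ⌊D⌋₊,
      ∑ k ∈ Finset.Icc 1 ⌊K⌋₊, ‖innerS a H Q α c d k‖ ^ 2 := rfl

/-- The "shapes" `κ = (k, q₁, q₂)`, `k ≤ K₀`, `q₁, q₂ ≤ Q₀`, of the terms of `∑_k ‖S(c,d,k)‖²`.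
[folklore] -/
def shapes (K₀ Q₀ : ℕ) : Finset (ℕ × ℕ × ℕ) :=
  Finset.Icc 1 K₀ ×ˢ (Finset.Icc 1 Q₀ ×ˢ Finset.Icc 1 Q₀)

/-- The pairs of heights `η = (h₁, h₂)`, `h₁, h₂ ≤ H₀`. [folklore] -/
def hpairs (H₀ : ℕ) : Finset (ℕ × ℕ) := Finset.Icc 1 H₀ ×ˢ Finset.Icc 1 H₀

/-- `l(κ, η) = h₁ q₂ − h₂ q₁` (BFI p. 227: the variable `l` of `h₁q₂ − h₂q₁ = l`). [folklore] -/
def lval (κ : ℕ × ℕ × ℕ) (η : ℕ × ℕ) : ℤ := (η.1 : ℤ) * κ.2.2 - (η.2 : ℤ) * κ.2.1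

/-- `n(κ, η) = a k (h₁ q₂ − h₂ q₁)` (BFI p. 227: `ak(h₁q₂ − h₂q₁) = n`). [folklore] -/
def nval (a : ℤ) (κ : ℕ × ℕ × ℕ) (η : ℕ × ℕ) : ℤ := a * κ.1 * lval κ η

/-- `r(κ) = q₁ q₂` (BFI p. 227: `q₁q₂ = r`). [folklore] -/
def rval (κ : ℕ × ℕ × ℕ) : ℕ := κ.2.1 * κ.2.2

/-- The weight `w(κ, η) = α(h₁,q₁) conj α(h₂,q₂)`. [folklore] -/
def wcoef (α : ℕ → ℕ → ℂ) (κ : ℕ × ℕ × ℕ) (η : ℕ × ℕ) : ℂ := α η.1 κ.2.1 * conj (α η.2 κ.2.2)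

/-- The Kloosterman-fraction phase of Lemma 1 at modulus `c` (i.e. `s = 1`):
`F_{c,d}(n, r) = e(n (rd)‾/c)` if `(rd, c) = 1` and `0` otherwise, with `(rd)‾` the inverse of
`rd` modulo `c` taken in `[0, c)`. [cite: BombieriFriedlanderIwaniecActa1986, §2 Lemma 1 p. 208] -/
def kfrac (c d : ℕ) (n : ℤ) (r : ℕ) : ℂ :=
  if (r * d).Coprime c then
    (𝐞 ((n : ℝ) * ((((r * d : ℕ) : ZMod c)⁻¹).val : ℝ) / c) : ℂ)
  else 0

/-- `‖e(x)‖ = 1` (as a complex number). [folklore] -/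
theorem norm_e (x : ℝ) : ‖((𝐞 x : Circle) : ℂ)‖ = 1 := Circle.norm_coe _

/-- `‖F_{c,d}(n,r)‖ ≤ 1`. [folklore] -/
theorem norm_kfrac_le (c d : ℕ) (n : ℤ) (r : ℕ) : ‖kfrac c d n r‖ ≤ 1 := by
  unfold kfrac
  split_ifs
  · rw [norm_e]
  · simp

/-- `F_{c,d}(−n, r) = conj F_{c,d}(n, r)`. [folklore] -/
theorem kfrac_neg (c d : ℕ) (n : ℤ) (r : ℕ) : kfrac c d (-n) r = conj (kfrac c d n r) := by
  unfold kfrac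
  split_ifs
  · rw [← Circle.coe_inv_eq_conj, ← AddChar.map_neg_eq_inv]
    congr 2
    push_cast
    ring
  · simp

/-- **The phase identity behind "squaring and changing the order of summation"** (BFI p. 227):
for `(dq₁, c) = (dq₂, c) = 1`,
`e(h₁k·a(dq₁)‾/c) · conj e(h₂k·a(dq₂)‾/c) = e(n·(q₁q₂d)‾/c)` with `n = ak(h₁q₂ − h₂q₁)`,
because `(dq₁)‾ ≡ q₂ (q₁q₂d)‾` and `(dq₂)‾ ≡ q₁ (q₁q₂d)‾ (mod c)`.
[cite: BombieriFriedlanderIwaniecActa1986, §8 p. 227] -/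
theorem phase_mul_conj_phase (a : ℤ) {c d q₁ q₂ : ℕ} (hc : 0 < c) (h₁cop : c.Coprime (d * q₁))
    (h₂cop : c.Coprime (d * q₂)) (h₁ h₂ k : ℕ) :
    (𝐞 (((((a : ZMod c) * ((d * q₁ : ℕ) : ZMod c)⁻¹).val : ℕ) : ℝ) * h₁ * k / c) : ℂ) *
        conj (𝐞 (((((a : ZMod c) * ((d * q₂ : ℕ) : ZMod c)⁻¹).val : ℕ) : ℝ) * h₂ * k / c) : ℂ) =
      (𝐞 (((a * k * ((h₁ : ℤ) * q₂ - (h₂ : ℤ) * q₁) : ℤ) : ℝ) *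
          ((((q₁ * q₂ * d : ℕ) : ZMod c)⁻¹).val : ℝ) / c) : ℂ) := by
  haveI : NeZero c := ⟨hc.ne'⟩
  set ρ₁ : ℕ := ((a : ZMod c) * ((d * q₁ : ℕ) : ZMod c)⁻¹).val with hρ₁
  set ρ₂ : ℕ := ((a : ZMod c) * ((d * q₂ : ℕ) : ZMod c)⁻¹).val with hρ₂
  set u : ZMod c := ((q₁ * q₂ * d : ℕ) : ZMod c)⁻¹ with hu
  set m : ℤ := a * k * ((h₁ : ℤ) * q₂ - (h₂ : ℤ) * q₁) with hm
  -- the congruence `ρ₁ h₁ k − ρ₂ h₂ k ≡ m · u (mod c)`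
  have hcop : (q₁ * q₂ * d).Coprime c := by
    rw [Nat.coprime_mul_iff_left, Nat.coprime_mul_iff_left]
    exact ⟨⟨Nat.Coprime.coprime_mul_left h₁cop.symm, Nat.Coprime.coprime_mul_left h₂cop.symm⟩,
      Nat.Coprime.coprime_mul_right h₁cop.symm⟩
  have hu1 : ((q₁ * q₂ * d : ℕ) : ZMod c) * u = 1 := ZMod.coe_mul_inv_eq_one _ hcop
  have hi1 : ((d * q₁ : ℕ) : ZMod c) * ((d * q₁ : ℕ) : ZMod c)⁻¹ = 1 :=
    ZMod.coe_mul_inv_eq_one _ h₁cop.symm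
  have hi2 : ((d * q₂ : ℕ) : ZMod c) * ((d * q₂ : ℕ) : ZMod c)⁻¹ = 1 :=
    ZMod.coe_mul_inv_eq_one _ h₂cop.symm
  have hinv1 : ((d * q₁ : ℕ) : ZMod c)⁻¹ = (q₂ : ZMod c) * u := by
    push_cast at hu1 hi1 ⊢
    linear_combination ((q₂ : ZMod c) * u) * hi1 - ((d : ZMod c) * q₁)⁻¹ * hu1
  have hinv2 : ((d * q₂ : ℕ) : ZMod c)⁻¹ = (q₁ : ZMod c) * u := by
    push_cast at hu1 hi2 ⊢
    linear_combination ((q₁ : ZMod c) * u) * hi2 - ((d : ZMod c) * q₂)⁻¹ * hu1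
  have hcong : (((ρ₁ * h₁ * k : ℕ) : ℤ) - ((ρ₂ * h₂ * k : ℕ) : ℤ) - m * (u.val : ℤ) : ZMod c) = 0 := by
    push_cast
    rw [hρ₁, hρ₂, ZMod.natCast_zmod_val, ZMod.natCast_zmod_val, ZMod.natCast_zmod_val, hinv1, hinv2,
      hm]
    push_cast
    ring
  obtain ⟨t, ht⟩ := (ZMod.intCast_zmod_eq_zero_iff_dvd _ c).1 (by exact_mod_cast hcong)
  have hc0 : (c : ℝ) ≠ 0 := by exact_mod_cast hc.ne'
  have key : (ρ₁ : ℝ) * h₁ * k / c + -((ρ₂ : ℝ) * h₂ * k / c) =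
      (m : ℝ) * ((u.val : ℕ) : ℝ) / c + ((t : ℤ) : ℝ) := by
    have := congrArg (fun z : ℤ => (z : ℝ)) ht
    push_cast at this
    field_simp
    linear_combination this
  rw [← Circle.coe_inv_eq_conj, ← AddChar.map_neg_eq_inv, ← Circle.coe_mul,
    ← AddChar.map_add_eq_mul, key, AddChar.map_add_eq_mul, Circle.coe_mul, e_intCast, mul_one]


/-- `S(c,d,k)` as a single sum over the pairs `p = (h, q)`. [folklore] -/
theorem innerS_eq_sum_pairs (a : ℤ) (H Q : ℝ) (α : ℕ → ℕ → ℂ) (c d k : ℕ) :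
    innerS a H Q α c d k = ∑ p ∈ Finset.Icc 1 ⌊H⌋₊ ×ˢ Finset.Icc 1 ⌊Q⌋₊,
      if c.Coprime (d * p.2) then
        α p.1 p.2 *
          (𝐞 (((((a : ZMod c) * ((d * p.2 : ℕ) : ZMod c)⁻¹).val : ℕ) : ℝ) * p.1 * k / c) : ℂ)
      else 0 := by
  unfold innerS
  rw [Finset.sum_product]
  refine Finset.sum_congr rfl fun h _ => ?_
  rw [Finset.sum_filter]

/-- `(q₁ q₂ d, c) = 1 ↔ (c, d q₁) = 1 ∧ (c, d q₂) = 1`. [folklore] -/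
theorem coprime_rd_iff (c d q₁ q₂ : ℕ) :
    (q₁ * q₂ * d).Coprime c ↔ c.Coprime (d * q₁) ∧ c.Coprime (d * q₂) := by
  rw [Nat.coprime_mul_iff_left, Nat.coprime_mul_iff_left, Nat.coprime_mul_iff_right,
    Nat.coprime_mul_iff_right, Nat.coprime_comm (m := d), Nat.coprime_comm (m := q₁),
    Nat.coprime_comm (m := q₂)]
  tauto

/-- **Squaring out** (BFI p. 227: "Squaring and changing the order of summation we represent
`𝒜(C,D,K,H,Q)` as `𝒦(C, D, |a|HKQ, Q², 1)`"), pointwise in `(c, d)`: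
`∑_{k ≤ K} ‖S(c,d,k)‖² = ∑_{κ=(k,q₁,q₂)} ∑_{η=(h₁,h₂)} w(κ,η) F_{c,d}(n(κ,η), r(κ))`.
[cite: BombieriFriedlanderIwaniecActa1986, §8 p. 227] -/
theorem sum_norm_innerS_sq_eq (a : ℤ) (K H Q : ℝ) (α : ℕ → ℕ → ℂ) {c : ℕ} (hc : 0 < c) (d : ℕ) :
    ((∑ k ∈ Finset.Icc 1 ⌊K⌋₊, ‖innerS a H Q α c d k‖ ^ 2 : ℝ) : ℂ) =
      ∑ κ ∈ shapes ⌊K⌋₊ ⌊Q⌋₊, ∑ η ∈ hpairs ⌊H⌋₊,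
        wcoef α κ η * kfrac c d (nval a κ η) (rval κ) := by
  set P : Finset (ℕ × ℕ) := Finset.Icc 1 ⌊H⌋₊ ×ˢ Finset.Icc 1 ⌊Q⌋₊ with hP
  -- each square as a double sum over pairs
  have hsq : ∀ k : ℕ, ((‖innerS a H Q α c d k‖ ^ 2 : ℝ) : ℂ) = ∑ p ∈ P, ∑ p' ∈ P,
      wcoef α (k, (p.2, p'.2)) (p.1, p'.1) *
        kfrac c d (nval a (k, (p.2, p'.2)) (p.1, p'.1)) (rval (k, (p.2, p'.2))) := by
    intro k
    rw [← Complex.normSq_eq_norm_sq, ← Complex.mul_conj, innerS_eq_sum_pairs, map_sum,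
      Finset.sum_mul_sum]
    refine Finset.sum_congr rfl fun p _ => Finset.sum_congr rfl fun p' _ => ?_
    unfold wcoef kfrac nval lval rval
    simp only
    by_cases h1 : c.Coprime (d * p.2)
    · by_cases h2 : c.Coprime (d * p'.2)
      · have hcop : (p.2 * p'.2 * d).Coprime c := (coprime_rd_iff c d p.2 p'.2).2 ⟨h1, h2⟩
        rw [if_pos h1, if_pos h2, if_pos hcop, map_mul, mul_mul_mul_comm,
          phase_mul_conj_phase a hc h1 h2]
      · have hcop : ¬ (p.2 * p'.2 * d).Coprime c := fun h =>
          h2 ((coprime_rd_iff c d p.2 p'.2).1 h).2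
        rw [if_pos h1, if_neg h2, if_neg hcop, map_zero, mul_zero, mul_zero]
    · have hcop : ¬ (p.2 * p'.2 * d).Coprime c := fun h =>
        h1 ((coprime_rd_iff c d p.2 p'.2).1 h).1
      rw [if_neg h1, zero_mul, if_neg hcop, mul_zero]
  calc ((∑ k ∈ Finset.Icc 1 ⌊K⌋₊, ‖innerS a H Q α c d k‖ ^ 2 : ℝ) : ℂ)
      = ∑ k ∈ Finset.Icc 1 ⌊K⌋₊, ∑ p ∈ P, ∑ p' ∈ P, wcoef α (k, (p.2, p'.2)) (p.1, p'.1) *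
          kfrac c d (nval a (k, (p.2, p'.2)) (p.1, p'.1)) (rval (k, (p.2, p'.2))) := by
        rw [Complex.ofReal_sum]
        exact Finset.sum_congr rfl fun k _ => hsq k
    _ = ∑ x ∈ Finset.Icc 1 ⌊K⌋₊ ×ˢ (P ×ˢ P), wcoef α (x.1, (x.2.1.2, x.2.2.2)) (x.2.1.1, x.2.2.1) *
          kfrac c d (nval a (x.1, (x.2.1.2, x.2.2.2)) (x.2.1.1, x.2.2.1))
            (rval (x.1, (x.2.1.2, x.2.2.2))) := by
        rw [Finset.sum_product (Finset.Icc 1 ⌊K⌋₊) (P ×ˢ P)]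
        refine Finset.sum_congr rfl fun k _ => ?_
        rw [Finset.sum_product P P]
    _ = ∑ y ∈ shapes ⌊K⌋₊ ⌊Q⌋₊ ×ˢ hpairs ⌊H⌋₊, wcoef α y.1 y.2 * kfrac c d (nval a y.1 y.2) (rval y.1) := by
        refine Finset.sum_nbij' (fun x => ((x.1, (x.2.1.2, x.2.2.2)), (x.2.1.1, x.2.2.1)))
          (fun y => (y.1.1, ((y.2.1, y.1.2.1), (y.2.2, y.1.2.2)))) ?_ ?_ ?_ ?_ ?_
        · intro x hx
          simp only [hP, shapes, hpairs, Finset.mem_product] at hx ⊢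
          tauto
        · intro y hy
          simp only [hP, shapes, hpairs, Finset.mem_product] at hy ⊢
          tauto
        · rintro ⟨k, ⟨h₁, q₁⟩, ⟨h₂, q₂⟩⟩ _
          rfl
        · rintro ⟨⟨k, q₁, q₂⟩, ⟨h₁, h₂⟩⟩ _
          rfl
        · intro x _
          rfl
    _ = _ := by rw [Finset.sum_product (shapes ⌊K⌋₊ ⌊Q⌋₊) (hpairs ⌊H⌋₊)]


/-! ### The coefficients `B(n, r)` -/

/-- **The coefficients `B_{nr}`** of BFI p. 227:
`B(n, r) = ∑_{k ≤ K₀} ∑_{q₁q₂ = r} ∑_{h₁,h₂ ≤ H₀, ak(h₁q₂ − h₂q₁) = n} α(h₁,q₁) conj α(h₂,q₂)`,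
as a sum over the fibre of `(κ, η) ↦ (n(κ,η), r(κ))`.
[cite: BombieriFriedlanderIwaniecActa1986, §8 p. 227] -/
def Bcoef (a : ℤ) (α : ℕ → ℕ → ℂ) (K₀ H₀ Q₀ : ℕ) (n : ℤ) (r : ℕ) : ℂ :=
  ∑ x ∈ (shapes K₀ Q₀ ×ˢ hpairs H₀).filter (fun x => (nval a x.1 x.2, rval x.1) = (n, r)),
    wcoef α x.1 x.2

/-- `|l(κ, η)| ≤ H₀ Q₀` on the index sets. [folklore] -/
theorem abs_lval_le {K₀ H₀ Q₀ : ℕ} {κ : ℕ × ℕ × ℕ} {η : ℕ × ℕ} (hκ : κ ∈ shapes K₀ Q₀)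
    (hη : η ∈ hpairs H₀) : |lval κ η| ≤ (H₀ : ℤ) * Q₀ := by
  simp only [shapes, hpairs, Finset.mem_product, Finset.mem_Icc] at hκ hη
  unfold lval
  have h1 : (η.1 : ℤ) * κ.2.2 ≤ H₀ * Q₀ := by
    have := hη.1.2; have := hκ.2.2.2
    exact mul_le_mul (by exact_mod_cast hη.1.2) (by exact_mod_cast hκ.2.2.2) (by positivity)
      (by positivity)
  have h2 : (η.2 : ℤ) * κ.2.1 ≤ H₀ * Q₀ :=
    mul_le_mul (by exact_mod_cast hη.2.2) (by exact_mod_cast hκ.2.1.2) (by positivity)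
      (by positivity)
  rw [abs_le]
  constructor <;> nlinarith [h1, h2, (by positivity : (0 : ℤ) ≤ (η.1 : ℤ) * κ.2.2),
    (by positivity : (0 : ℤ) ≤ (η.2 : ℤ) * κ.2.1)]

/-- `|n(κ, η)| ≤ |a| K₀ H₀ Q₀` on the index sets. [folklore] -/
theorem abs_nval_le (a : ℤ) {K₀ H₀ Q₀ : ℕ} {κ : ℕ × ℕ × ℕ} {η : ℕ × ℕ} (hκ : κ ∈ shapes K₀ Q₀)
    (hη : η ∈ hpairs H₀) : |nval a κ η| ≤ |a| * K₀ * H₀ * Q₀ := by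
  have hl := abs_lval_le hκ hη
  simp only [shapes, Finset.mem_product, Finset.mem_Icc] at hκ
  unfold nval
  rw [abs_mul, abs_mul, Nat.abs_cast]
  have hk : (κ.1 : ℤ) ≤ K₀ := by exact_mod_cast hκ.1.2
  calc |a| * (κ.1 : ℤ) * |lval κ η| ≤ |a| * K₀ * ((H₀ : ℤ) * Q₀) := by gcongr
    _ = _ := by ring

/-- `r(κ) = q₁q₂ ∈ [1, Q₀²]` on the index set. [folklore] -/
theorem rval_mem_Icc {K₀ Q₀ : ℕ} {κ : ℕ × ℕ × ℕ} (hκ : κ ∈ shapes K₀ Q₀) :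
    rval κ ∈ Finset.Icc 1 (Q₀ * Q₀) := by
  simp only [shapes, Finset.mem_product, Finset.mem_Icc] at hκ
  unfold rval
  rw [Finset.mem_Icc]
  exact ⟨Nat.one_le_iff_ne_zero.2 (Nat.mul_ne_zero (by omega) (by omega)),
    Nat.mul_le_mul hκ.2.1.2 hκ.2.2.2⟩

/-- `(n(κ,η), r(κ))` lands in `[−N₀, N₀] × [1, R₀]` when `|a|K₀H₀Q₀ ≤ N₀`, `Q₀² ≤ R₀`. [folklore] -/
theorem nval_rval_mapsTo (a : ℤ) {K₀ H₀ Q₀ N₀ R₀ : ℕ}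
    (hN : |a| * K₀ * H₀ * Q₀ ≤ (N₀ : ℤ)) (hR : Q₀ * Q₀ ≤ R₀) :
    ∀ x ∈ shapes K₀ Q₀ ×ˢ hpairs H₀,
      (nval a x.1 x.2, rval x.1) ∈ Finset.Icc (-(N₀ : ℤ)) N₀ ×ˢ Finset.Icc 1 R₀ := by
  intro x hx
  rw [Finset.mem_product] at hx ⊢
  have h1 := abs_nval_le a hx.1 hx.2
  have h2 := rval_mem_Icc hx.1
  rw [Finset.mem_Icc] at h2 ⊢
  rw [Finset.mem_Icc, ← abs_le]
  exact ⟨h1.trans hN, h2.1, h2.2.trans hR⟩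

/-- **Regrouping by `(n, r)`**: for any `F`,
`∑_{κ} ∑_{η} w(κ,η) F(n(κ,η), r(κ)) = ∑_{|n| ≤ N₀} ∑_{r ≤ R₀} B(n,r) F(n,r)`.
[cite: BombieriFriedlanderIwaniecActa1986, §8 p. 227] -/
theorem sum_wcoef_mul_eq (a : ℤ) (α : ℕ → ℕ → ℂ) {K₀ H₀ Q₀ N₀ R₀ : ℕ}
    (hN : |a| * K₀ * H₀ * Q₀ ≤ (N₀ : ℤ)) (hR : Q₀ * Q₀ ≤ R₀) (F : ℤ → ℕ → ℂ) :
    ∑ κ ∈ shapes K₀ Q₀, ∑ η ∈ hpairs H₀, wcoef α κ η * F (nval a κ η) (rval κ) =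
      ∑ n ∈ Finset.Icc (-(N₀ : ℤ)) N₀, ∑ r ∈ Finset.Icc 1 R₀, Bcoef a α K₀ H₀ Q₀ n r * F n r := by
  rw [← Finset.sum_product', ← Finset.sum_product',
    ← Finset.sum_fiberwise_of_maps_to (nval_rval_mapsTo a hN hR)]
  refine Finset.sum_congr rfl fun j _ => ?_
  unfold Bcoef
  rw [Finset.sum_mul]
  refine Finset.sum_congr rfl fun x hx => ?_
  rw [Finset.mem_filter] at hx
  obtain ⟨h1, h2⟩ := Prod.mk_inj.1 hx.2
  rw [h1, h2]


/-! ### Bounds for the coefficients: generalities -/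

/-- `‖w(κ, η)‖ ≤ 1` when `|α| ≤ 1`. [folklore] -/
theorem norm_wcoef_le {α : ℕ → ℕ → ℂ} (hα : ∀ h q, ‖α h q‖ ≤ 1) (κ : ℕ × ℕ × ℕ) (η : ℕ × ℕ) :
    ‖wcoef α κ η‖ ≤ 1 := by
  unfold wcoef
  rw [norm_mul, Complex.norm_conj]
  exact mul_le_one₀ (hα _ _) (norm_nonneg _) (hα _ _)

/-- Cauchy's inequality on the support: `‖∑_{i∈s} z_i‖² ≤ #{i ∈ s : z_i ≠ 0} · ∑_{i∈s} ‖z_i‖²`.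
[folklore] -/
theorem norm_sum_sq_le_card_mul {ι : Type*} (s : Finset ι) (z : ι → ℂ) :
    ‖∑ i ∈ s, z i‖ ^ 2 ≤ #(s.filter (fun i => z i ≠ 0)) * ∑ i ∈ s, ‖z i‖ ^ 2 := by
  classical
  calc ‖∑ i ∈ s, z i‖ ^ 2 = ‖∑ i ∈ s.filter (fun i => z i ≠ 0), z i‖ ^ 2 := by
        rw [Finset.sum_filter_ne_zero]
    _ ≤ (∑ i ∈ s.filter (fun i => z i ≠ 0), ‖z i‖) ^ 2 := by
        gcongr
        exact norm_sum_le _ _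
    _ ≤ #(s.filter (fun i => z i ≠ 0)) * ∑ i ∈ s.filter (fun i => z i ≠ 0), ‖z i‖ ^ 2 :=
        sq_sum_le_card_mul_sum_sq
    _ ≤ #(s.filter (fun i => z i ≠ 0)) * ∑ i ∈ s, ‖z i‖ ^ 2 :=
        mul_le_mul_of_nonneg_left (Finset.sum_le_sum_of_subset_of_nonneg
          (Finset.filter_subset _ _) fun _ _ _ => by positivity) (by positivity)

/-- **A divisor count**: for `m ≠ 0` and `g` injective, the number of pairs `(q, h) ∈ A × B` with
`g(h) · q = m` is at most `τ(|m|)` (`q` runs over divisors of `|m|` and determines `h`).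
[folklore] -/
theorem card_filter_mul_eq_le_sigma {g : ℕ → ℤ} (hg : Function.Injective g) {m : ℤ} (hm : m ≠ 0)
    (A B : Finset ℕ) :
    #((A ×ˢ B).filter (fun p : ℕ × ℕ => g p.2 * p.1 = m)) ≤ σ 0 m.natAbs := by
  rw [ArithmeticFunction.sigma_zero_apply]
  refine Finset.card_le_card_of_injOn Prod.fst ?_ ?_
  · intro p hp
    simp only [Finset.coe_filter, Set.mem_setOf_eq] at hp
    rw [Finset.mem_coe, Nat.mem_divisors]
    refine ⟨?_, Int.natAbs_ne_zero.2 hm⟩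
    rw [← Int.natCast_dvd]
    exact ⟨g p.2, by rw [← hp.2]; ring⟩
  · intro p hp p' hp' h
    simp only [Finset.coe_filter, Set.mem_setOf_eq] at hp hp'
    have hq : (p.1 : ℤ) ≠ 0 := by
      rintro h0
      rw [h0, mul_zero] at hp
      exact hm hp.2.symm
    have hg' : g p.2 = g p'.2 := by
      have h' := hp.2.trans hp'.2.symm
      rw [← h] at h'
      exact mul_right_cancel₀ hq h'
    exact Prod.ext h (hg hg')

/-- On the index set, `n(κ, η) = 0 ↔ h₂ q₁ = h₁ q₂` (`a ≠ 0`, `k ≥ 1`). [folklore] -/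
theorem nval_eq_zero_iff {a : ℤ} (ha : a ≠ 0) {K₀ Q₀ : ℕ} {κ : ℕ × ℕ × ℕ} (hκ : κ ∈ shapes K₀ Q₀)
    (η : ℕ × ℕ) : nval a κ η = 0 ↔ (η.2 : ℤ) * κ.2.1 = (η.1 : ℤ) * κ.2.2 := by
  simp only [shapes, Finset.mem_product, Finset.mem_Icc] at hκ
  have hk : (κ.1 : ℤ) ≠ 0 := by have := hκ.1.1; positivity
  unfold nval lval
  rw [mul_eq_zero, mul_eq_zero, sub_eq_zero, or_iff_right, eq_comm]
  push Not
  exact ⟨ha, hk⟩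

/-! ### The diagonal `n = 0` -/

/-- **The diagonal count** (BFI p. 227: "The terms on the diagonal (`n = 0`) … contribute trivially
`≪ CDK ∑_{h₁q₂ = h₂q₁} 1 ≪ CDHKQ (log 2HQ)⁴`"), in the form
`#{(κ, η) : n(κ, η) = 0} = ∑_{k} ∑_{q₂} ∑_{h₁} #{(q₁, h₂) : h₂ q₁ = h₁ q₂}`.
[cite: BombieriFriedlanderIwaniecActa1986, §8 p. 227] -/
theorem card_nval_eq_zero (a : ℤ) (ha : a ≠ 0) (K₀ H₀ Q₀ : ℕ) :
    #((shapes K₀ Q₀ ×ˢ hpairs H₀).filter (fun x => nval a x.1 x.2 = 0)) =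
      K₀ * ∑ q₂ ∈ Finset.Icc 1 Q₀, ∑ h₁ ∈ Finset.Icc 1 H₀,
        #((Finset.Icc 1 Q₀ ×ˢ Finset.Icc 1 H₀).filter
          (fun p : ℕ × ℕ => ((p.2 : ℕ) : ℤ) * p.1 = (h₁ : ℤ) * q₂)) := by
  rw [Finset.card_filter, Finset.sum_product, shapes, Finset.sum_product]
  have key : ∀ k ∈ Finset.Icc 1 K₀,
      (∑ qq ∈ Finset.Icc 1 Q₀ ×ˢ Finset.Icc 1 Q₀, ∑ η ∈ hpairs H₀,
        if nval a (k, qq) η = 0 then 1 else 0) =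
      ∑ q₂ ∈ Finset.Icc 1 Q₀, ∑ h₁ ∈ Finset.Icc 1 H₀,
        #((Finset.Icc 1 Q₀ ×ˢ Finset.Icc 1 H₀).filter
          (fun p : ℕ × ℕ => ((p.2 : ℕ) : ℤ) * p.1 = (h₁ : ℤ) * q₂)) := by
    intro k hk
    rw [Finset.sum_product, Finset.sum_comm]
    refine Finset.sum_congr rfl fun q₂ hq₂ => ?_
    rw [hpairs]
    simp_rw [Finset.sum_product]
    rw [Finset.sum_comm]
    refine Finset.sum_congr rfl fun h₁ _ => ?_
    rw [Finset.card_filter, Finset.sum_product]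
    refine Finset.sum_congr rfl fun q₁ hq₁ => Finset.sum_congr rfl fun h₂ _ => ?_
    have hκ : (k, (q₁, q₂)) ∈ shapes K₀ Q₀ := by
      simp only [shapes, Finset.mem_product]; exact ⟨hk, hq₁, hq₂⟩
    simp only [nval_eq_zero_iff ha hκ]
  rw [Finset.sum_congr rfl key, Finset.sum_const, Nat.card_Icc, smul_eq_mul, Nat.add_sub_cancel]

/-- **The diagonal bound**: `∑_{r ≤ R₀} ‖B(0, r)‖ ≤ K₀ Q₀ H₀ T` whenever `τ(m) ≤ T` for all
`1 ≤ m ≤ H₀ Q₀` (and `Q₀² ≤ R₀`). [cite: BombieriFriedlanderIwaniecActa1986, §8 p. 227] -/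
theorem sum_norm_Bcoef_zero_le {a : ℤ} (ha : a ≠ 0) {α : ℕ → ℕ → ℂ} (hα : ∀ h q, ‖α h q‖ ≤ 1)
    {K₀ H₀ Q₀ R₀ : ℕ} (hR : Q₀ * Q₀ ≤ R₀) {T : ℝ}
    (hT : ∀ m : ℕ, 1 ≤ m → m ≤ H₀ * Q₀ → ((σ 0 m : ℕ) : ℝ) ≤ T) :
    ∑ r ∈ Finset.Icc 1 R₀, ‖Bcoef a α K₀ H₀ Q₀ 0 r‖ ≤ K₀ * Q₀ * H₀ * T := by
  set X := shapes K₀ Q₀ ×ˢ hpairs H₀ with hX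
  -- ‖B(0,r)‖ ≤ #{x : (n, r)(x) = (0, r)}
  have h1 : ∀ r, ‖Bcoef a α K₀ H₀ Q₀ 0 r‖ ≤
      #(X.filter (fun x => (nval a x.1 x.2, rval x.1) = ((0 : ℤ), r))) := by
    intro r
    unfold Bcoef
    refine (norm_sum_le _ _).trans ?_
    calc _ ≤ ∑ x ∈ X.filter (fun x => (nval a x.1 x.2, rval x.1) = ((0 : ℤ), r)), (1 : ℝ) :=
          Finset.sum_le_sum fun x _ => norm_wcoef_le hα _ _
      _ = _ := by rw [Finset.sum_const, nsmul_eq_mul, mul_one]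
  -- summing over `r` collects the fibres of `rval` over `{n = 0}`
  have h2 : ∑ r ∈ Finset.Icc 1 R₀, #(X.filter (fun x => (nval a x.1 x.2, rval x.1) = ((0 : ℤ), r))) =
      #(X.filter (fun x => nval a x.1 x.2 = 0)) := by
    rw [Finset.card_eq_sum_card_fiberwise (f := fun x => rval x.1)
      (s := X.filter (fun x => nval a x.1 x.2 = 0)) (t := Finset.Icc 1 R₀) ?_]
    · refine Finset.sum_congr rfl fun r _ => ?_
      rw [Finset.filter_filter]
      congr 1
      refine Finset.filter_congr fun x _ => ?_
      rw [Prod.mk_inj]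
    · intro x hx
      rw [Finset.coe_filter, Set.mem_setOf_eq, hX, Finset.mem_product] at hx
      exact Finset.Icc_subset_Icc_right hR (rval_mem_Icc hx.1.1)
  -- the count
  have h3 : (#(X.filter (fun x => nval a x.1 x.2 = 0)) : ℝ) ≤ K₀ * Q₀ * H₀ * T := by
    rw [hX, card_nval_eq_zero a ha]
    push_cast
    have hin : ∀ q₂ ∈ Finset.Icc 1 Q₀, ∀ h₁ ∈ Finset.Icc 1 H₀,
        (#((Finset.Icc 1 Q₀ ×ˢ Finset.Icc 1 H₀).filter
          (fun p : ℕ × ℕ => ((p.2 : ℕ) : ℤ) * p.1 = (h₁ : ℤ) * q₂)) : ℝ) ≤ T := by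
      intro q₂ hq₂ h₁ hh₁
      rw [Finset.mem_Icc] at hq₂ hh₁
      have hm : ((h₁ : ℤ) * q₂) ≠ 0 := by have := hq₂.1; have := hh₁.1; positivity
      have hcount := card_filter_mul_eq_le_sigma (g := fun h : ℕ => (h : ℤ)) Nat.cast_injective hm
        (Finset.Icc 1 Q₀) (Finset.Icc 1 H₀)
      have hnat : ((h₁ : ℤ) * q₂).natAbs = h₁ * q₂ := by
        rw [Int.natAbs_mul, Int.natAbs_natCast, Int.natAbs_natCast]
      rw [hnat] at hcount
      calc _ ≤ ((σ 0 (h₁ * q₂) : ℕ) : ℝ) := by exact_mod_cast hcount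
        _ ≤ T := hT _ (Nat.one_le_iff_ne_zero.2 (Nat.mul_ne_zero (by omega) (by omega)))
            (Nat.mul_le_mul hh₁.2 hq₂.2)
    calc _ ≤ (K₀ : ℝ) * ∑ q₂ ∈ Finset.Icc 1 Q₀, ∑ h₁ ∈ Finset.Icc 1 H₀, T := by
          gcongr with q₂ hq₂ h₁ hh₁
          exact hin q₂ hq₂ h₁ hh₁
      _ = _ := by
          rw [Finset.sum_const, Finset.sum_const, Nat.card_Icc, Nat.card_Icc]
          simp only [Nat.add_sub_cancel, nsmul_eq_mul]
          ring
  calc ∑ r ∈ Finset.Icc 1 R₀, ‖Bcoef a α K₀ H₀ Q₀ 0 r‖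
      ≤ ∑ r ∈ Finset.Icc 1 R₀,
          (#(X.filter (fun x => (nval a x.1 x.2, rval x.1) = ((0 : ℤ), r))) : ℝ) :=
        Finset.sum_le_sum fun r _ => h1 r
    _ = (#(X.filter (fun x => nval a x.1 x.2 = 0)) : ℝ) := by exact_mod_cast h2
    _ ≤ _ := h3


/-! ### Off the diagonal: `‖B‖²` -/

/-- The fibre sums `c_κ(n) = ∑_{η : n(κ,η) = n} w(κ, η)` (for fixed shape `κ = (k, q₁, q₂)`), so that
`B(n, r) = ∑_{κ : r(κ) = r} c_κ(n)`. [folklore] -/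
def cfib (a : ℤ) (α : ℕ → ℕ → ℂ) (H₀ : ℕ) (κ : ℕ × ℕ × ℕ) (n : ℤ) : ℂ :=
  ∑ η ∈ (hpairs H₀).filter (fun η => nval a κ η = n), wcoef α κ η

/-- `B(n, r) = ∑_{κ ∈ shapes, r(κ) = r} c_κ(n)`. [folklore] -/
theorem Bcoef_eq_sum_cfib (a : ℤ) (α : ℕ → ℕ → ℂ) (K₀ H₀ Q₀ : ℕ) (n : ℤ) (r : ℕ) :
    Bcoef a α K₀ H₀ Q₀ n r = ∑ κ ∈ (shapes K₀ Q₀).filter (fun κ => rval κ = r), cfib a α H₀ κ n := by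
  unfold Bcoef cfib
  rw [Finset.sum_filter, Finset.sum_product, Finset.sum_filter]
  refine Finset.sum_congr rfl fun κ _ => ?_
  by_cases hr : rval κ = r
  · rw [if_pos hr, Finset.sum_filter]
    refine Finset.sum_congr rfl fun η _ => ?_
    simp only [Prod.mk_inj, hr, and_true]
  · rw [if_neg hr]
    refine Finset.sum_eq_zero fun η _ => ?_
    rw [if_neg]
    intro h
    exact hr (Prod.mk_inj.1 h).2

/-- **The support of `κ ↦ c_κ(n)` on `{r(κ) = r}` has at most `τ(|n|) τ(r)` elements** (`n ≠ 0`):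
`k ∣ n` and `q₁ ∣ r` determine `κ = (k, q₁, r/q₁)` (BFI p. 227, the factor `(HKQ)^ε` in the bound
for `‖B‖²`). [cite: BombieriFriedlanderIwaniecActa1986, §8 p. 227] -/
theorem card_support_cfib_le (a : ℤ) (α : ℕ → ℕ → ℂ) (K₀ H₀ Q₀ : ℕ) {n : ℤ} (hn : n ≠ 0) {r : ℕ}
    (hr : r ≠ 0) :
    #(((shapes K₀ Q₀).filter (fun κ => rval κ = r)).filter (fun κ => cfib a α H₀ κ n ≠ 0)) ≤
      σ 0 n.natAbs * σ 0 r := by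
  rw [ArithmeticFunction.sigma_zero_apply, ArithmeticFunction.sigma_zero_apply,
    ← Finset.card_product]
  refine Finset.card_le_card_of_injOn (fun κ => (κ.1, κ.2.1)) ?_ ?_
  · intro κ hκ
    simp only [Finset.coe_filter, Finset.mem_filter, Set.mem_setOf_eq] at hκ
    obtain ⟨⟨_, hrv⟩, hc⟩ := hκ
    rw [Finset.mem_coe, Finset.mem_product, Nat.mem_divisors, Nat.mem_divisors]
    obtain ⟨η, hη, -⟩ := Finset.exists_ne_zero_of_sum_ne_zero hc
    rw [Finset.mem_filter] at hη
    refine ⟨⟨?_, Int.natAbs_ne_zero.2 hn⟩, ⟨?_, hr⟩⟩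
    · rw [← Int.natCast_dvd, ← hη.2]
      unfold nval
      exact ⟨a * lval κ η, by ring⟩
    · rw [← hrv]
      unfold rval
      exact Dvd.intro _ rfl
  · intro κ hκ κ' hκ' h
    simp only [Finset.coe_filter, Finset.mem_filter, Set.mem_setOf_eq] at hκ hκ'
    obtain ⟨hk, hq₁⟩ := Prod.mk_inj.1 h
    have hq1pos : 0 < κ.2.1 := by
      have := hκ.1.1
      simp only [shapes, Finset.mem_product, Finset.mem_Icc] at this
      exact this.2.1.1
    have hq₂ : κ.2.2 = κ'.2.2 := by
      have e := hκ.1.2.trans hκ'.1.2.symm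
      unfold rval at e
      rw [← hq₁] at e
      exact Nat.eq_of_mul_eq_mul_left hq1pos e
    exact Prod.ext hk (Prod.ext hq₁ hq₂)

/-- **`∑_n ‖c_κ(n)‖² ≤ #{(η, η') : l(κ,η) = l(κ,η')}`** for a fixed shape `κ` (BFI p. 227:
`‖B‖² ≪ … ∑_l (∑_{h₁q₂ − h₂q₁ = l} 1)² = … #{(h₁−h₃)q₂ = (h₂−h₄)q₁}`), over any finite set of `n`.
[cite: BombieriFriedlanderIwaniecActa1986, §8 p. 227] -/
theorem sum_norm_cfib_sq_le {a : ℤ} (ha : a ≠ 0) {α : ℕ → ℕ → ℂ} (hα : ∀ h q, ‖α h q‖ ≤ 1)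
    {K₀ H₀ Q₀ : ℕ} {κ : ℕ × ℕ × ℕ} (hκ : κ ∈ shapes K₀ Q₀) (Nset : Finset ℤ) :
    ∑ n ∈ Nset, ‖cfib a α H₀ κ n‖ ^ 2 ≤
      #((hpairs H₀ ×ˢ hpairs H₀).filter (fun x => lval κ x.1 = lval κ x.2)) := by
  classical
  set f : ℤ → ℕ := fun n => #((hpairs H₀).filter (fun η => nval a κ η = n)) with hf
  have h1 : ∀ n, ‖cfib a α H₀ κ n‖ ^ 2 ≤ ((f n : ℕ) : ℝ) ^ 2 := by
    intro n
    refine pow_le_pow_left₀ (norm_nonneg _) ?_ 2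
    unfold cfib
    refine (norm_sum_le _ _).trans ?_
    calc _ ≤ ∑ η ∈ (hpairs H₀).filter (fun η => nval a κ η = n), (1 : ℝ) :=
          Finset.sum_le_sum fun η _ => norm_wcoef_le hα _ _
      _ = f n := by rw [Finset.sum_const, nsmul_eq_mul, mul_one]
  have h2 : ∑ n ∈ Nset, ((f n : ℕ) : ℝ) ^ 2 ≤
      ∑ n ∈ (hpairs H₀).image (nval a κ), ((f n : ℕ) : ℝ) ^ 2 := by
    rw [← Finset.sum_filter_ne_zero Nset]
    refine Finset.sum_le_sum_of_subset_of_nonneg ?_ (fun _ _ _ => by positivity)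
    intro n hn
    rw [Finset.mem_filter] at hn
    have hfn : f n ≠ 0 := by
      intro h0
      apply hn.2
      rw [h0]
      simp
    obtain ⟨η, hη⟩ := Finset.card_ne_zero.1 hfn
    rw [Finset.mem_filter] at hη
    exact Finset.mem_image.2 ⟨η, hη.1, hη.2⟩
  have h3 : ∑ n ∈ (hpairs H₀).image (nval a κ), ((f n : ℕ) : ℝ) ^ 2 =
      ∑ η ∈ hpairs H₀, ((f (nval a κ η) : ℕ) : ℝ) := by
    rw [← Finset.sum_fiberwise_of_maps_to (g := nval a κ) (s := hpairs H₀)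
      (t := (hpairs H₀).image (nval a κ)) (fun η hη => Finset.mem_image_of_mem _ hη)]
    refine Finset.sum_congr rfl fun n _ => ?_
    rw [Finset.sum_congr rfl (fun η hη => by rw [(Finset.mem_filter.1 hη).2]), Finset.sum_const,
      nsmul_eq_mul, hf, sq]
  have h4 : ∀ η ∈ hpairs H₀,
      f (nval a κ η) = #((hpairs H₀).filter (fun η' => lval κ η = lval κ η')) := by
    intro η _
    simp only [hf]
    congr 1
    refine Finset.filter_congr fun η' _ => ?_
    have hk : a * (κ.1 : ℤ) ≠ 0 := by
      refine mul_ne_zero ha ?_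
      simp only [shapes, Finset.mem_product, Finset.mem_Icc] at hκ
      have := hκ.1.1
      positivity
    unfold nval
    constructor
    · intro h; exact (mul_left_cancel₀ hk h).symm
    · intro h; rw [h]
  have h5 : ∑ η ∈ hpairs H₀, #((hpairs H₀).filter (fun η' => lval κ η = lval κ η')) =
      #((hpairs H₀ ×ˢ hpairs H₀).filter (fun x => lval κ x.1 = lval κ x.2)) := by
    rw [Finset.card_filter, Finset.sum_product]
    refine Finset.sum_congr rfl fun η _ => ?_
    rw [Finset.card_filter]
  calc ∑ n ∈ Nset, ‖cfib a α H₀ κ n‖ ^ 2 ≤ ∑ n ∈ Nset, ((f n : ℕ) : ℝ) ^ 2 :=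
        Finset.sum_le_sum fun n _ => h1 n
    _ ≤ _ := h2
    _ = _ := h3
    _ = ((∑ η ∈ hpairs H₀, #((hpairs H₀).filter (fun η' => lval κ η = lval κ η')) : ℕ) : ℝ) := by
        push_cast
        exact Finset.sum_congr rfl fun η hη => by rw [h4 η hη]
    _ = _ := by rw [h5]


/-- The equation `l(κ,(h₁,h₂)) = l(κ,(h₃,h₄))`, i.e. `(h₂ − h₄) q₁ = (h₁ − h₃) q₂`, determines `h₄`
from the other variables (`q₁ ≥ 1`): at most one `h₄` in any finite set. [folklore] -/
theorem card_filter_lval_eq_le_one (k q₁ q₂ : ℕ) (hq₁ : 1 ≤ q₁) (η : ℕ × ℕ) (h₃ : ℕ)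
    (s : Finset ℕ) :
    #(s.filter (fun h₄ => lval (k, (q₁, q₂)) η = lval (k, (q₁, q₂)) (h₃, h₄))) ≤ 1 := by
  refine Finset.card_le_one.2 fun x hx y hy => ?_
  rw [Finset.mem_filter] at hx hy
  unfold lval at hx hy
  simp only at hx hy
  have hq : (q₁ : ℤ) ≠ 0 := by positivity
  have : (x : ℤ) * q₁ = (y : ℤ) * q₁ := by linarith
  exact_mod_cast mul_right_cancel₀ hq this

/-- **The lattice-point count** (BFI p. 227:
`#{q₁,q₂,h₁,h₂,h₃,h₄ : (h₁ − h₃)q₂ = (h₂ − h₄)q₁} ≪ (HQ)^ε (H²Q² + H³Q)`), for fixed `k, q₂`, summed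
over `q₁ ≤ Q₀`: `∑_{q₁} #{(η,η') : l = l'} ≤ H₀²(Q₀ + H₀ T)` whenever `τ(m) ≤ T` for `1 ≤ m ≤ H₀Q₀`
(the pairs with `h₁ = h₃` force `h₂ = h₄`: `≤ Q₀ H₀²`; for `h₁ ≠ h₃`, `q₁ ∣ (h₁−h₃)q₂` and `h₄` is
determined: `≤ τ((h₁−h₃)q₂) H₀³`). [cite: BombieriFriedlanderIwaniecActa1986, §8 p. 227] -/
theorem sum_card_lval_eq_le {H₀ Q₀ : ℕ} (k : ℕ) {q₂ : ℕ} (hq₂ : q₂ ∈ Finset.Icc 1 Q₀) {T : ℝ}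
    (hT0 : 0 ≤ T) (hT : ∀ m : ℕ, 1 ≤ m → m ≤ H₀ * Q₀ → ((σ 0 m : ℕ) : ℝ) ≤ T) :
    ∑ q₁ ∈ Finset.Icc 1 Q₀,
      (#((hpairs H₀ ×ˢ hpairs H₀).filter
        (fun x => lval (k, (q₁, q₂)) x.1 = lval (k, (q₁, q₂)) x.2)) : ℝ) ≤
      (H₀ : ℝ) ^ 2 * (Q₀ + H₀ * T) := by
  rw [Finset.mem_Icc] at hq₂
  -- the count for fixed `η = (h₁, h₂)` and `h₃`, as a function of `q₁`
  set cnt : ℕ → ℕ × ℕ → ℕ → ℕ := fun q₁ η h₃ =>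
    #((Finset.Icc 1 H₀).filter (fun h₄ => lval (k, (q₁, q₂)) η = lval (k, (q₁, q₂)) (h₃, h₄)))
    with hcnt
  -- reshuffling: `#{(η, η')} = ∑_η ∑_{h₃} cnt`
  have hresh : ∀ q₁ : ℕ,
      #((hpairs H₀ ×ˢ hpairs H₀).filter (fun x => lval (k, (q₁, q₂)) x.1 = lval (k, (q₁, q₂)) x.2)) =
        ∑ η ∈ hpairs H₀, ∑ h₃ ∈ Finset.Icc 1 H₀, cnt q₁ η h₃ := by
    intro q₁
    rw [Finset.card_filter, Finset.sum_product]
    refine Finset.sum_congr rfl fun η _ => ?_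
    rw [hpairs, Finset.sum_product]
    refine Finset.sum_congr rfl fun h₃ _ => ?_
    simp only [hcnt, Finset.card_filter]
  -- the two bounds for `∑_{q₁} cnt`
  have hb1 : ∀ η ∈ hpairs H₀, ∀ h₃ ∈ Finset.Icc 1 H₀,
      (∑ q₁ ∈ Finset.Icc 1 Q₀, (cnt q₁ η h₃ : ℝ)) ≤ Q₀ := by
    intro η _ h₃ _
    calc _ ≤ ∑ q₁ ∈ Finset.Icc 1 Q₀, (1 : ℝ) := by
          refine Finset.sum_le_sum fun q₁ hq₁ => ?_
          rw [Finset.mem_Icc] at hq₁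
          exact_mod_cast card_filter_lval_eq_le_one k q₁ q₂ hq₁.1 η h₃ _
      _ = Q₀ := by simp
  have hb2 : ∀ η ∈ hpairs H₀, ∀ h₃ ∈ Finset.Icc 1 H₀, h₃ ≠ η.1 →
      (∑ q₁ ∈ Finset.Icc 1 Q₀, (cnt q₁ η h₃ : ℝ)) ≤ T := by
    intro η hη h₃ hh₃ hne
    simp only [hpairs, Finset.mem_product, Finset.mem_Icc] at hη hh₃
    set m : ℤ := ((η.1 : ℤ) - h₃) * q₂ with hm
    have hm0 : m ≠ 0 := by
      refine mul_ne_zero (sub_ne_zero.2 ?_) (by have := hq₂.1; positivity)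
      exact_mod_cast (Ne.symm hne)
    have hcount := card_filter_mul_eq_le_sigma (g := fun h : ℕ => (η.2 : ℤ) - h)
      (fun x y hxy => by exact_mod_cast sub_right_injective hxy) hm0 (Finset.Icc 1 Q₀) (Finset.Icc 1 H₀)
    have hsum : (∑ q₁ ∈ Finset.Icc 1 Q₀, cnt q₁ η h₃) =
        #((Finset.Icc 1 Q₀ ×ˢ Finset.Icc 1 H₀).filter
          (fun p : ℕ × ℕ => ((η.2 : ℤ) - p.2) * p.1 = m)) := by
      rw [Finset.card_filter, Finset.sum_product]
      refine Finset.sum_congr rfl fun q₁ _ => ?_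
      simp only [hcnt, Finset.card_filter]
      refine Finset.sum_congr rfl fun h₄ _ => ?_
      unfold lval
      simp only [hm]
      congr 1
      apply propext
      constructor <;> intro h <;> linarith
    have hmabs : m.natAbs ≤ H₀ * Q₀ := by
      have h1 : |(η.1 : ℤ) - h₃| ≤ H₀ := by
        rw [abs_le]; constructor <;> linarith [hη.1.1, hη.1.2, hh₃.1, hh₃.2]
      have : (m.natAbs : ℤ) ≤ H₀ * Q₀ := by
        rw [Int.natCast_natAbs, hm, abs_mul, Nat.abs_cast]
        exact mul_le_mul h1 (by exact_mod_cast hq₂.2) (by positivity) (by positivity)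
      exact_mod_cast this
    calc (∑ q₁ ∈ Finset.Icc 1 Q₀, (cnt q₁ η h₃ : ℝ))
        = ((∑ q₁ ∈ Finset.Icc 1 Q₀, cnt q₁ η h₃ : ℕ) : ℝ) := by push_cast; rfl
      _ ≤ ((σ 0 m.natAbs : ℕ) : ℝ) := by rw [hsum]; exact_mod_cast hcount
      _ ≤ T := hT _ (Nat.one_le_iff_ne_zero.2 (Int.natAbs_ne_zero.2 hm0)) hmabs
  -- assemble
  calc ∑ q₁ ∈ Finset.Icc 1 Q₀,
        (#((hpairs H₀ ×ˢ hpairs H₀).filter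
          (fun x => lval (k, (q₁, q₂)) x.1 = lval (k, (q₁, q₂)) x.2)) : ℝ)
      = ∑ q₁ ∈ Finset.Icc 1 Q₀, ∑ η ∈ hpairs H₀, ∑ h₃ ∈ Finset.Icc 1 H₀, (cnt q₁ η h₃ : ℝ) := by
        refine Finset.sum_congr rfl fun q₁ _ => ?_
        rw [hresh q₁]
        push_cast
        rfl
    _ = ∑ η ∈ hpairs H₀, ∑ h₃ ∈ Finset.Icc 1 H₀, ∑ q₁ ∈ Finset.Icc 1 Q₀, (cnt q₁ η h₃ : ℝ) := by
        rw [Finset.sum_comm]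
        refine Finset.sum_congr rfl fun η _ => ?_
        rw [Finset.sum_comm]
    _ ≤ ∑ η ∈ hpairs H₀, ∑ h₃ ∈ Finset.Icc 1 H₀, ((if h₃ = η.1 then (Q₀ : ℝ) else 0) + T) := by
        refine Finset.sum_le_sum fun η hη => Finset.sum_le_sum fun h₃ hh₃ => ?_
        by_cases h : h₃ = η.1
        · rw [if_pos h]
          linarith [hb1 η hη h₃ hh₃]
        · rw [if_neg h, zero_add]
          exact hb2 η hη h₃ hh₃ h
    _ ≤ ∑ η ∈ hpairs H₀, ((Q₀ : ℝ) + H₀ * T) := by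
        refine Finset.sum_le_sum fun η _ => ?_
        rw [Finset.sum_add_distrib, Finset.sum_ite_eq', Finset.sum_const, Nat.card_Icc,
          nsmul_eq_mul]
        simp only [Nat.add_sub_cancel]
        split_ifs
        · exact le_rfl
        · linarith [(by positivity : (0 : ℝ) ≤ Q₀)]
    _ = _ := by
        rw [Finset.sum_const, hpairs, Finset.card_product, Nat.card_Icc, nsmul_eq_mul]
        simp only [Nat.add_sub_cancel]
        push_cast
        ring


/-- **The bound for `‖B‖²` off the diagonal** (BFI p. 227:
"`‖B‖² = ∑_{n ≥ 1} ∑_r |B_{nr}|² ≪ (HKQ)^ε K ∑_{q₁,q₂ ≤ Q} ∑_l (∑_{h₁q₂ − h₂q₁ = l} 1)² ≪ (HKQ)^ε K (H²Q² + H³Q)`"),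
in the explicit form: for any finite set `Nset` of non-zero `n`,
`∑_{n ∈ Nset} ∑_{r ≤ R₀} ‖B(n, r)‖² ≤ T_n T_r · K₀ Q₀ H₀² (Q₀ + H₀ T)`, where `T_n ≥ τ(|n|)` on `Nset`,
`T_r ≥ τ(r)` for `r ≤ R₀`, `T ≥ τ(m)` for `m ≤ H₀Q₀` (Cauchy over the `≤ τ(|n|)τ(r)` shapes carrying a
given `(n, r)`, then the lattice-point count). [cite: BombieriFriedlanderIwaniecActa1986, §8 p. 227] -/
theorem sum_norm_Bcoef_sq_le {a : ℤ} (ha : a ≠ 0) {α : ℕ → ℕ → ℂ} (hα : ∀ h q, ‖α h q‖ ≤ 1)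
    {K₀ H₀ Q₀ R₀ : ℕ} (hR : Q₀ * Q₀ ≤ R₀) {Nset : Finset ℤ} (hN0 : (0 : ℤ) ∉ Nset)
    {Tn Tr T : ℝ} (hTn0 : 0 ≤ Tn) (hTr0 : 0 ≤ Tr) (hT0 : 0 ≤ T)
    (hTn : ∀ n ∈ Nset, ((σ 0 n.natAbs : ℕ) : ℝ) ≤ Tn)
    (hTr : ∀ r : ℕ, 1 ≤ r → r ≤ R₀ → ((σ 0 r : ℕ) : ℝ) ≤ Tr)
    (hT : ∀ m : ℕ, 1 ≤ m → m ≤ H₀ * Q₀ → ((σ 0 m : ℕ) : ℝ) ≤ T) :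
    ∑ n ∈ Nset, ∑ r ∈ Finset.Icc 1 R₀, ‖Bcoef a α K₀ H₀ Q₀ n r‖ ^ 2 ≤
      Tn * Tr * (K₀ * Q₀ * ((H₀ : ℝ) ^ 2 * (Q₀ + H₀ * T))) := by
  set S := shapes K₀ Q₀ with hS
  -- pointwise: Cauchy over the shapes carrying `(n, r)`
  have hpt : ∀ n ∈ Nset, ∀ r ∈ Finset.Icc 1 R₀, ‖Bcoef a α K₀ H₀ Q₀ n r‖ ^ 2 ≤
      Tn * Tr * ∑ κ ∈ S.filter (fun κ => rval κ = r), ‖cfib a α H₀ κ n‖ ^ 2 := by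
    intro n hn r hr
    rw [Finset.mem_Icc] at hr
    have hn0 : n ≠ 0 := fun h => hN0 (h ▸ hn)
    rw [Bcoef_eq_sum_cfib]
    refine (norm_sum_sq_le_card_mul _ _).trans ?_
    refine mul_le_mul_of_nonneg_right ?_ (Finset.sum_nonneg fun _ _ => by positivity)
    calc (#((S.filter (fun κ => rval κ = r)).filter (fun κ => cfib a α H₀ κ n ≠ 0)) : ℝ)
        ≤ ((σ 0 n.natAbs * σ 0 r : ℕ) : ℝ) := by
          exact_mod_cast card_support_cfib_le a α K₀ H₀ Q₀ hn0 (by omega)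
      _ ≤ Tn * Tr := by
          push_cast
          exact mul_le_mul (hTn n hn) (hTr r hr.1 hr.2) (by positivity) hTn0
  -- summing over `r` collects the fibres of `κ ↦ r(κ)`
  have hfib : ∀ n, ∑ r ∈ Finset.Icc 1 R₀, ∑ κ ∈ S.filter (fun κ => rval κ = r),
      ‖cfib a α H₀ κ n‖ ^ 2 = ∑ κ ∈ S, ‖cfib a α H₀ κ n‖ ^ 2 := fun n =>
    Finset.sum_fiberwise_of_maps_to
      (fun κ hκ => Finset.Icc_subset_Icc_right hR (rval_mem_Icc hκ)) _
  -- the per-shape bound, summed over the shapes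
  have hshape : ∑ κ ∈ S, ∑ n ∈ Nset, ‖cfib a α H₀ κ n‖ ^ 2 ≤
      K₀ * Q₀ * ((H₀ : ℝ) ^ 2 * (Q₀ + H₀ * T)) := by
    calc ∑ κ ∈ S, ∑ n ∈ Nset, ‖cfib a α H₀ κ n‖ ^ 2
        ≤ ∑ κ ∈ S, (#((hpairs H₀ ×ˢ hpairs H₀).filter (fun x => lval κ x.1 = lval κ x.2)) : ℝ) :=
          Finset.sum_le_sum fun κ hκ => sum_norm_cfib_sq_le ha hα hκ Nset
      _ = ∑ k ∈ Finset.Icc 1 K₀, ∑ q₂ ∈ Finset.Icc 1 Q₀, ∑ q₁ ∈ Finset.Icc 1 Q₀,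
            (#((hpairs H₀ ×ˢ hpairs H₀).filter
              (fun x => lval (k, (q₁, q₂)) x.1 = lval (k, (q₁, q₂)) x.2)) : ℝ) := by
          rw [hS, shapes, Finset.sum_product]
          refine Finset.sum_congr rfl fun k _ => ?_
          rw [Finset.sum_product, Finset.sum_comm]
      _ ≤ ∑ k ∈ Finset.Icc 1 K₀, ∑ q₂ ∈ Finset.Icc 1 Q₀, (H₀ : ℝ) ^ 2 * (Q₀ + H₀ * T) :=
          Finset.sum_le_sum fun k _ => Finset.sum_le_sum fun q₂ hq₂ =>
            sum_card_lval_eq_le k hq₂ hT0 hT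
      _ = _ := by
          rw [Finset.sum_const, Finset.sum_const, Nat.card_Icc, Nat.card_Icc]
          simp only [Nat.add_sub_cancel, nsmul_eq_mul]
          ring
  calc ∑ n ∈ Nset, ∑ r ∈ Finset.Icc 1 R₀, ‖Bcoef a α K₀ H₀ Q₀ n r‖ ^ 2
      ≤ ∑ n ∈ Nset, ∑ r ∈ Finset.Icc 1 R₀,
          Tn * Tr * ∑ κ ∈ S.filter (fun κ => rval κ = r), ‖cfib a α H₀ κ n‖ ^ 2 :=
        Finset.sum_le_sum fun n hn => Finset.sum_le_sum fun r hr => hpt n hn r hr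
    _ = Tn * Tr * ∑ κ ∈ S, ∑ n ∈ Nset, ‖cfib a α H₀ κ n‖ ^ 2 := by
        rw [Finset.sum_comm (s := S), Finset.mul_sum]
        refine Finset.sum_congr rfl fun n _ => ?_
        rw [← Finset.mul_sum, hfib n]
    _ ≤ _ := mul_le_mul_of_nonneg_left hshape (by positivity)

end BFI

end Literature.NumberTheory.Sieve
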